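import Literature.NumberTheory.Sieve.RoughOmegaCellsClassesBVBoxBound
import Literature.NumberTheory.Sieve.RoughOmegaCellsClassesBVRest
import Literature.NumberTheory.Sieve.RoughOmegaCellsClassesBVParams
import HarnessLib

/-!
# Bombieri–Vinogradov for the `Ω`-cells of the rough integers (level `X^{1/4}`)

Topic `Literature/NumberTheory/Sieve`, sub-namespace `RoughCellsAP`.  Everything here is PROVED.
Write `Φ_{j+1}(X, Y; q, c) = #{b ∈ roughIcc ⌈Y⌉ ⌊X⌋ : Ω b = j + 1, b ≡ c (q)}` for an `Ω`-cell of
the `Y`-rough integers in a residue class.  The companion file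
`RoughOmegaCellsClassesEquidistribution.lean` proves the equidistribution of the cells in the
reduced classes to a FIXED modulus (rate `X/log² Y`); here the moduli are AVERAGED, in the manner of
the Bombieri–Vinogradov theorem, up to the level `X^{1/4}`, with an arbitrary logarithmic saving:

* `exists_sum_abs_cellClassDisc_le` — for every `n` and `A` there is `C ≥ 0` with
  `Σ_{q ≤ X^{1/4}} |Φ_{j+1}(X,Y;q,c_q) − #{b ∈ Φ_{j+1}(X,Y) : (b,q)=1}/φ(q)| ≤ C X/(log X)^A`
  for all `2 ≤ Y ≤ X` with `log X ≤ n log Y`, all `j` and all reduced residues `c_q`.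

This is the theorem of Motohashi (1976) / Bombieri–Friedlander–Iwaniec (1986, Theorem 0) for the
Dirichlet convolution `1_{primes ≥ Y} ⋆ 1_{Φ_j}`, which represents `(ω ·) 1_{Φ_{j+1}}`
(`RoughOmegaCellsClassesBVPairs.lean`): the hyperbola `m p ≤ X` is covered by product boxes
(`…BVBoxes`), Theorem 0 (b) (PROVED in the tree, `BombieriFriedlanderIwaniecTheorem0b_holds`) bounds
each box (`…BVBoxBound`, the prime box carrying hypothesis (A₂) by `…BVPrimes`), the boundary and
the non-squarefree members are trivial (`…BVRest`, `…BVCounting`), the parameters are chosen in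
`…BVParams`; the cell `j = 0` is the Bombieri–Vinogradov theorem itself (`sum_abs_primesClassDisc_le`).

## References

* Y. Motohashi, *An induction principle for the generalization of Bombieri's prime number theorem*,
  Proc. Japan Acad. 52 (1976), 273–275.
* E. Bombieri, J. B. Friedlander, H. Iwaniec, *Primes in arithmetic progressions to large moduli*,
  Acta Math. 156 (1986), 203–251, §2 Theorem 0. [BombieriFriedlanderIwaniecActa1986]
* H. Iwaniec, E. Kowalski, *Analytic Number Theory*, AMS Coll. Publ. 53 (2004), Thm 17.4.
  [IwaniecKowalski2004]
-/

open Finset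
open scoped ArithmeticFunction.Omega

namespace Literature.NumberTheory.Sieve

namespace RoughCellsAP

open BFI

/-! Local notation (as in the companion files). -/
local notation3 (prettyPrint := false) "cellΩ" N₀:max T:max i:max =>
  Finset.filter (fun b : ℕ => ArithmeticFunction.cardFactors b = i) (roughIcc N₀ T)
local notation3 (prettyPrint := false) "primesIn" N₀:max T:max =>
  Finset.filter (fun p : ℕ => Nat.Prime p ∧ N₀ ≤ p) (Finset.Icc 1 T)
local notation3 (prettyPrint := false) "boxA" N₀:max T:max j:max δ:max k:max i:max =>
  Finset.filter (fun m : ℕ => BFI.InBox ((1 + δ) ^ k) 1 i m) (cellΩ N₀ T j)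
local notation3 (prettyPrint := false) "boxB" N₀:max T:max X:max δ:max k:max =>
  Finset.filter (fun p : ℕ => BFI.InBox X δ k p) (primesIn N₀ T)

/-! ### Small facts about the scales -/

/-- `log X ≤ n log Y` gives `X^{1/n} ≤ Y` (`X, Y > 0`, `n ≥ 1`). [folklore] -/
theorem rpow_inv_le_of_log_le {n : ℕ} (hn : 0 < n) {X Y : ℝ} (hX : 0 < X) (hY : 0 < Y)
    (h : Real.log X ≤ n * Real.log Y) : X ^ (1 / (n : ℝ)) ≤ Y := by
  have hn0 : (0 : ℝ) < n := by exact_mod_cast hn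
  rw [Real.rpow_def_of_pos hX, ← Real.exp_log hY]
  refine Real.exp_le_exp.2 ?_
  rw [mul_one_div, div_le_iff₀ hn0]; linarith

/-- `log X ≤ n log Y` gives `X ≤ Y^n` (`X, Y > 0`). [folklore] -/
theorem le_pow_of_log_le {n : ℕ} {X Y : ℝ} (hX : 0 < X) (hY : 0 < Y) (h : Real.log X ≤ n * Real.log Y) :
    X ≤ Y ^ n := by
  rw [← Real.exp_log hX, ← Real.exp_log (pow_pos hY n), Real.log_pow]
  exact Real.exp_le_exp.2 h

/-- The trivial bound for one term: `|a − b/φ| ≤ X` if `0 ≤ a, b ≤ X`, `φ ≥ 1`. [folklore] -/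
theorem abs_sub_div_le_of_le {a b X φ : ℝ} (ha0 : 0 ≤ a) (ha : a ≤ X) (hb0 : 0 ≤ b) (hb : b ≤ X)
    (hφ : 1 ≤ φ) : |a - b / φ| ≤ X := by
  have h1 : b / φ ≤ b := div_le_self hb0 hφ
  have h2 : 0 ≤ b / φ := div_nonneg hb0 (by linarith)
  rw [abs_le]; constructor <;> linarith

/-! ### The cells `1 ≤ j < n` for large `X` -/

set_option maxHeartbeats 400000 in
/-- **The cells `Ω = j + 1`, `1 ≤ j`, `j + 1 ≤ n`, for large `X`.**  For `n ≥ 1`, `A > 0` there are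
`C ≥ 0` and `x₁` such that for `X ≥ x₁`, `2 ≤ Y ≤ X`, `log X ≤ n log Y`, `1 ≤ j ≤ n − 1` and reduced
residues `c_q`: `Σ_{q ≤ X^{1/4}} |Φ_{j+1}(X,Y;q,c_q) − #{b ∈ Φ_{j+1} : (b,q)=1}/φ(q)| ≤ C X/(log X)^A`.
[cite: BombieriFriedlanderIwaniecActa1986, §2 Theorem 0 (b) p. 211] -/
theorem sum_abs_cellClassDisc_le_of_large {n : ℕ} (hn : 0 < n) {A : ℝ} (hA : 0 < A) :
    ∃ C x₁ : ℝ, 0 ≤ C ∧ ∀ X Y : ℝ, x₁ ≤ X → 2 ≤ Y → Y ≤ X → Real.log X ≤ n * Real.log Y →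
      ∀ j : ℕ, 1 ≤ j → j + 1 ≤ n → ∀ c : ℕ → ℕ, (∀ q : ℕ, 0 < q → (c q).Coprime q) →
        ∑ q ∈ Finset.Icc 1 ⌊X ^ ((1 : ℝ) / 4)⌋₊,
          |(#((cellΩ ⌈Y⌉₊ ⌊X⌋₊ (j + 1)).filter (fun b : ℕ => b ≡ c q [MOD q])) : ℝ) -
            (#((cellΩ ⌈Y⌉₊ ⌊X⌋₊ (j + 1)).filter (fun b : ℕ => b.Coprime q)) : ℝ) / (Nat.totient q : ℝ)| ≤
          C * X / Real.log X ^ A := by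
  have hn0 : (0 : ℝ) < n := by exact_mod_cast hn
  have hA' : 0 < 2 * A + 5 := by linarith
  obtain ⟨B₁, Cb, x₀, hB₁, hCb, hbox⟩ := sum_abs_pairDisc_box_le hn hA'
  obtain ⟨x₁, hx₁⟩ := Filter.eventually_atTop.1 (eventually_params hn A x₀ B₁)
  refine ⟨3 * 2 ^ (2 * A + 5) * Cb + (34 * n + 17), x₁, by positivity, ?_⟩
  intro X Y hX hY hYX hlog j hj hjn c hc
  obtain ⟨h16, h4nX, he2X, hx₀', h4n, hlev, he1, he2⟩ := hx₁ X hX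
  have hX0 : 0 < X := by linarith
  have hX1 : 1 ≤ X := by linarith
  have hL2 : 2 ≤ Real.log X := by rw [Real.le_log_iff_exp_le hX0]; exact he2X
  have hL1 : 1 ≤ Real.log X := by linarith
  have hL0 : 0 < Real.log X := by linarith
  have hY0 : 0 < Y := by linarith
  have hXY : X ^ (1 / (n : ℝ)) ≤ Y := rpow_inv_le_of_log_le hn hX0 hY0 hlog
  have hN₀2 : 2 ≤ ⌈Y⌉₊ := by
    have : (2 : ℝ) ≤ ⌈Y⌉₊ := hY.trans (Nat.le_ceil Y)
    exact_mod_cast this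
  -- parameters
  have hLA3 : 1 ≤ Real.log X ^ (A + 3) := Real.one_le_rpow hL1 (by linarith)
  have hδ0 : 0 < 1 / Real.log X ^ (A + 3) := by positivity
  have hδ1 : 1 / Real.log X ^ (A + 3) ≤ 1 := by rw [div_le_one (by positivity)]; exact hLA3
  have hK := lt_one_add_pow_floor hX0 hδ0 hδ1
  have hIle : (2 : ℝ) ^ ⌊Real.log X / (4 * Real.log 2)⌋₊ ≤ X ^ (1 / 4 : ℝ) := two_pow_floor_le hX1
  have hIge := rpow_quarter_le_two_mul_two_pow_floor hX0
  -- the structural inequality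
  have hstruct := sum_abs_cellClassDisc_le_boxes_add (N₀ := ⌈Y⌉₊) (j := j) hN₀2 hX0 hδ0 hK
    ⌊Real.log X / (4 * Real.log 2)⌋₊ ⌊X ^ ((1 : ℝ) / 4)⌋₊ hc
  refine hstruct.trans ?_
  -- the boxes
  have hboxes : ∑ ki ∈ Finset.range (⌊2 * Real.log X / (1 / Real.log X ^ (A + 3))⌋₊ + 1) ×ˢ
        Finset.range ⌊Real.log X / (4 * Real.log 2)⌋₊,
      ∑ q ∈ Finset.Icc 1 ⌊X ^ ((1 : ℝ) / 4)⌋₊,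
        |(#(((boxA ⌈Y⌉₊ ⌊X⌋₊ j (1 / Real.log X ^ (A + 3)) ki.1 ki.2) ×ˢ
              (boxB ⌈Y⌉₊ ⌊X⌋₊ X (1 / Real.log X ^ (A + 3)) ki.1)).filter
              (fun x : ℕ × ℕ => x.1 * x.2 ≡ c q [MOD q])) : ℝ) -
          (#(((boxA ⌈Y⌉₊ ⌊X⌋₊ j (1 / Real.log X ^ (A + 3)) ki.1 ki.2) ×ˢ
              (boxB ⌈Y⌉₊ ⌊X⌋₊ X (1 / Real.log X ^ (A + 3)) ki.1)).filter
              (fun x : ℕ × ℕ => (x.1 * x.2).Coprime q)) : ℝ) / (Nat.totient q : ℝ)| ≤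
      3 * 2 ^ (2 * A + 5) * Cb * X / Real.log X ^ A := by
    have hterm : ∀ ki ∈ Finset.range (⌊2 * Real.log X / (1 / Real.log X ^ (A + 3))⌋₊ + 1) ×ˢ
        Finset.range ⌊Real.log X / (4 * Real.log 2)⌋₊,
        ∑ q ∈ Finset.Icc 1 ⌊X ^ ((1 : ℝ) / 4)⌋₊,
          |(#(((boxA ⌈Y⌉₊ ⌊X⌋₊ j (1 / Real.log X ^ (A + 3)) ki.1 ki.2) ×ˢ
                (boxB ⌈Y⌉₊ ⌊X⌋₊ X (1 / Real.log X ^ (A + 3)) ki.1)).filter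
                (fun x : ℕ × ℕ => x.1 * x.2 ≡ c q [MOD q])) : ℝ) -
            (#(((boxA ⌈Y⌉₊ ⌊X⌋₊ j (1 / Real.log X ^ (A + 3)) ki.1 ki.2) ×ˢ
                (boxB ⌈Y⌉₊ ⌊X⌋₊ X (1 / Real.log X ^ (A + 3)) ki.1)).filter
                (fun x : ℕ × ℕ => (x.1 * x.2).Coprime q)) : ℝ) / (Nat.totient q : ℝ)| ≤
          Cb * X / (Real.log X / 2) ^ (2 * A + 5) := by
      intro ki hki
      have hi : ki.2 < ⌊Real.log X / (4 * Real.log 2)⌋₊ := Finset.mem_range.1 (Finset.mem_product.1 hki).2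
      have hi' : (2 : ℝ) ^ (ki.2 + 1) ≤ X ^ (1 / 4 : ℝ) :=
        le_trans (pow_le_pow_right₀ (by norm_num) (by omega)) hIle
      exact hbox X Y _ hx₀' h4n h4nX h16 hlev hY hYX hXY hδ0 hδ1 j ki.1 ki.2 hj hi' c hc
    refine (Finset.sum_le_sum hterm).trans ?_
    rw [Finset.sum_const, nsmul_eq_mul, Finset.card_product, Finset.card_range, Finset.card_range,
      Nat.cast_mul]
    calc ((⌊2 * Real.log X / (1 / Real.log X ^ (A + 3))⌋₊ + 1 : ℕ) : ℝ) * (⌊Real.log X / (4 * Real.log 2)⌋₊ : ℝ) *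
          (Cb * X / (Real.log X / 2) ^ (2 * A + 5))
        ≤ 3 * Real.log X ^ (A + 5) * (Cb * X / (Real.log X / 2) ^ (2 * A + 5)) :=
          mul_le_mul_of_nonneg_right (card_boxes_le hL1 hA) (by positivity)
      _ = 3 * 2 ^ (2 * A + 5) * Cb * X / Real.log X ^ A := boxes_total_eq hL0
  -- the rest
  have hQ0 : (0 : ℝ) ≤ ⌊X ^ ((1 : ℝ) / 4)⌋₊ := Nat.cast_nonneg _
  have hQ : (⌊X ^ ((1 : ℝ) / 4)⌋₊ : ℝ) ≤ X ^ (1 / 4 : ℝ) := Nat.floor_le (by positivity)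
  have hlQ0 : 0 ≤ Real.log (⌊X ^ ((1 : ℝ) / 4)⌋₊ : ℝ) := Real.log_natCast_nonneg _
  have hlQ : Real.log (⌊X ^ ((1 : ℝ) / 4)⌋₊ : ℝ) ≤ Real.log X := by
    rcases Nat.eq_zero_or_pos ⌊X ^ ((1 : ℝ) / 4)⌋₊ with h | h
    · rw [h, Nat.cast_zero, Real.log_zero]; exact hL0.le
    · have h1 : (1 : ℝ) ≤ ⌊X ^ ((1 : ℝ) / 4)⌋₊ := by exact_mod_cast h
      refine Real.log_le_log (by linarith) (hQ.trans ?_)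
      calc X ^ (1 / 4 : ℝ) ≤ X ^ (1 : ℝ) := Real.rpow_le_rpow_of_exponent_le hX1 (by norm_num)
        _ = X := Real.rpow_one X
  have hP0 : 0 ≤ X / 2 ^ ⌊Real.log X / (4 * Real.log 2)⌋₊ := by positivity
  have hP : X / 2 ^ ⌊Real.log X / (4 * Real.log 2)⌋₊ ≤ 2 * X ^ (3 / 4 : ℝ) := by
    have h1 : 0 < (2 : ℝ) ^ ⌊Real.log X / (4 * Real.log 2)⌋₊ := by positivity
    rw [div_le_iff₀ h1]
    have h2 : X = X ^ (3 / 4 : ℝ) * X ^ (1 / 4 : ℝ) := by rw [← Real.rpow_add hX0]; norm_num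
    calc X = X ^ (3 / 4 : ℝ) * X ^ (1 / 4 : ℝ) := h2
      _ ≤ X ^ (3 / 4 : ℝ) * (2 * 2 ^ ⌊Real.log X / (4 * Real.log 2)⌋₊) := mul_le_mul_of_nonneg_left hIge (by positivity)
      _ = 2 * X ^ (3 / 4 : ℝ) * 2 ^ ⌊Real.log X / (4 * Real.log 2)⌋₊ := by ring
  have hδX : 1 / Real.log X ^ (A + 3) * X = X / Real.log X ^ (A + 3) := one_div_mul_eq_div _ _
  have hT : (⌊X⌋₊ : ℝ) / ((⌈Y⌉₊ : ℝ) - 1) ≤ 2 * X ^ (1 - 1 / (n : ℝ)) := by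
    have h1 : (⌊X⌋₊ : ℝ) ≤ X := Nat.floor_le hX0.le
    have h2 : Y / 2 ≤ (⌈Y⌉₊ : ℝ) - 1 := by have := Nat.le_ceil Y; linarith
    have h3 : 0 < Y / 2 := by linarith
    calc (⌊X⌋₊ : ℝ) / ((⌈Y⌉₊ : ℝ) - 1) ≤ X / (Y / 2) :=
          div_le_div₀ hX0.le h1 h3 h2
      _ ≤ X / (X ^ (1 / (n : ℝ)) / 2) := div_le_div_of_nonneg_left hX0.le (by positivity) (by linarith)
      _ = 2 * X ^ (1 - 1 / (n : ℝ)) := by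
          rw [Real.rpow_sub hX0, Real.rpow_one]; field_simp
  have hs0 : (0 : ℝ) ≤ Nat.sqrt ⌊X⌋₊ := Nat.cast_nonneg _
  have hs : (Nat.sqrt ⌊X⌋₊ : ℝ) ≤ X ^ (1 / 2 : ℝ) := by
    rw [← Real.sqrt_eq_rpow]
    refine Real.le_sqrt_of_sq_le ?_
    have h1 : ((Nat.sqrt ⌊X⌋₊) ^ 2 : ℕ) ≤ ⌊X⌋₊ := Nat.sqrt_le' ⌊X⌋₊
    have h2 : ((Nat.sqrt ⌊X⌋₊ : ℝ)) ^ 2 ≤ ⌊X⌋₊ := by exact_mod_cast h1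
    exact h2.trans (Nat.floor_le hX0.le)
  have hj0 : (0 : ℝ) ≤ j := Nat.cast_nonneg _
  have hjn' : (j : ℝ) + 1 ≤ n := by exact_mod_cast hjn
  have hrest := rest_total_le (n := n) (A := A) hL1 hX1 hj0 hjn' hP0 hP hδ0.le hδX hQ0 hQ hlQ0 hlQ hT hs0 hs he1 he2
  have hsum : (3 * 2 ^ (2 * A + 5) * Cb + (34 * n + 17)) * X / Real.log X ^ A =
      3 * 2 ^ (2 * A + 5) * Cb * X / Real.log X ^ A + (34 * n + 17) * X / Real.log X ^ A := by ring
  rw [hsum]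
  exact add_le_add hboxes hrest

/-! ### All cells, all `X` -/

/-- **Bombieri–Vinogradov for the `Ω`-cells of the rough integers, level `X^{1/4}`** (Motohashi
1976; Bombieri–Friedlander–Iwaniec 1986, Theorem 0): for every `n` and `A` there is `C ≥ 0` such
that for all `2 ≤ Y ≤ X` with `log X ≤ n log Y`, all `j` and all reduced residues `c_q`,
`Σ_{q ≤ X^{1/4}} |#{b ∈ roughIcc ⌈Y⌉ ⌊X⌋ : Ω b = j+1, b ≡ c_q (q)} − #{… : Ω b = j+1, (b,q) = 1}/φ(q)|
 ≤ C X/(log X)^A`. [cite: BombieriFriedlanderIwaniecActa1986, §2 Theorem 0 p. 211] -/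
theorem exists_sum_abs_cellClassDisc_le (n : ℕ) (A : ℝ) :
    ∃ C : ℝ, 0 ≤ C ∧ ∀ X Y : ℝ, 2 ≤ Y → Y ≤ X → Real.log X ≤ n * Real.log Y →
      ∀ (j : ℕ) (c : ℕ → ℕ), (∀ q : ℕ, 0 < q → (c q).Coprime q) →
        ∑ q ∈ Finset.Icc 1 ⌊X ^ ((1 : ℝ) / 4)⌋₊,
          |((((roughIcc ⌈Y⌉₊ ⌊X⌋₊).filter (fun b : ℕ =>
              ArithmeticFunction.cardFactors b = j + 1 ∧ Nat.ModEq q b (c q))).card : ℕ) : ℝ) -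
            ((((roughIcc ⌈Y⌉₊ ⌊X⌋₊).filter (fun b : ℕ =>
              ArithmeticFunction.cardFactors b = j + 1 ∧ b.Coprime q)).card : ℕ) : ℝ) /
              ((Nat.totient q : ℕ) : ℝ)| ≤ C * X / Real.log X ^ A := by
  rcases Nat.eq_zero_or_pos n with hn0 | hn
  · refine ⟨0, le_rfl, fun X Y hY hYX hlog j c hc => ?_⟩
    subst hn0
    have : 0 < Real.log X := Real.log_pos (by linarith)
    simp only [Nat.cast_zero, zero_mul] at hlog
    linarith
  -- `n ≥ 1`
  set A₁ : ℝ := max A 1 with hA₁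
  have hA₁0 : 0 < A₁ := lt_of_lt_of_le one_pos (le_max_right _ _)
  obtain ⟨C₁, x₁, hC₁, h₁⟩ := sum_abs_cellClassDisc_le_of_large hn hA₁0
  obtain ⟨C₀, x₀, h₀⟩ := sum_abs_primesClassDisc_le hA₁0
  set x₂ : ℝ := max (max x₁ x₀) 16 with hx₂
  have hx₂16 : 16 ≤ x₂ := le_max_right _ _
  set Cs : ℝ := x₂ ^ (1 / 4 : ℝ) * (Real.log x₂ ^ A + Real.log 2 ^ A) with hCs
  have hlog2 : 0 < Real.log 2 := Real.log_pos (by norm_num)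
  have hlogx₂ : 0 < Real.log x₂ := Real.log_pos (by linarith)
  have hCs0 : 0 ≤ Cs := by positivity
  refine ⟨C₁ + max C₀ 0 + Cs, by positivity, fun X Y hY hYX hlog j c hc => ?_⟩
  have hX0 : 0 < X := by linarith
  have hX1 : 1 ≤ X := by linarith
  have hlogX : 0 < Real.log X := Real.log_pos (by linarith)
  have hpow : 0 < Real.log X ^ A := Real.rpow_pos_of_pos hlogX A
  have hunit : 0 ≤ X / Real.log X ^ A := by positivity
  have hm0 : 0 ≤ max C₀ 0 := le_max_right _ _
  -- rewrite the cell filters as iterated filters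
  have hsplit : ∀ (P : ℕ → Prop) [DecidablePred P],
      (roughIcc ⌈Y⌉₊ ⌊X⌋₊).filter (fun b : ℕ => ArithmeticFunction.cardFactors b = j + 1 ∧ P b) =
        (cellΩ ⌈Y⌉₊ ⌊X⌋₊ (j + 1)).filter P := fun P _ => (Finset.filter_filter _ _ _).symm
  rw [Finset.sum_congr rfl (fun q _ => by rw [hsplit, hsplit])]
  by_cases hXlarge : x₂ ≤ X
  · -- large `X`
    have hx₁X : x₁ ≤ X := le_trans (le_trans (le_max_left _ _) (le_max_left _ _)) hXlarge
    have hx₀X : x₀ ≤ X := le_trans (le_trans (le_max_right _ _) (le_max_left _ _)) hXlarge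
    have hlogX1 : 1 ≤ Real.log X := by
      rw [Real.le_log_iff_exp_le hX0]
      have : Real.exp 1 ≤ 16 := by have := Real.exp_one_lt_d9; linarith
      linarith
    have hpowA : Real.log X ^ A ≤ Real.log X ^ A₁ := Real.rpow_le_rpow_of_exponent_le hlogX1 (le_max_left _ _)
    have hmono : ∀ C : ℝ, 0 ≤ C → C * X / Real.log X ^ A₁ ≤ C * X / Real.log X ^ A := fun C hC =>
      div_le_div_of_nonneg_left (by positivity) hpow hpowA
    have hY0 : 0 < Y := by linarith
    rcases Nat.eq_zero_or_pos j with hj0 | hj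
    · -- the cell `Ω = 1`: the primes of `[⌈Y⌉, ⌊X⌋]`
      subst hj0
      simp only [zero_add, roughIcc_filter_cardFactors_one]
      have hN₀2 : 2 ≤ ⌈Y⌉₊ := by
        have : (2 : ℝ) ≤ ⌈Y⌉₊ := hY.trans (Nat.le_ceil Y); exact_mod_cast this
      have hNT : ⌈Y⌉₊ ≤ ⌊X⌋₊ + 1 := (Nat.ceil_mono hYX).trans (Nat.ceil_le_floor_add_one X)
      refine (h₀ X hx₀X ⌈Y⌉₊ ⌊X⌋₊ hN₀2 hNT (Nat.floor_le hX0.le) c hc).trans ?_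
      refine le_trans ?_ ((hmono (max C₀ 0) (le_max_right _ _)).trans ?_)
      · exact div_le_div_of_nonneg_right (mul_le_mul_of_nonneg_right (le_max_left _ _) hX0.le) (by positivity)
      · rw [mul_div_assoc, mul_div_assoc]
        exact mul_le_mul_of_nonneg_right (by linarith) hunit
    rcases le_or_gt (j + 1) n with hjn | hjn
    · -- `1 ≤ j`, `j + 1 ≤ n`
      refine (h₁ X Y hx₁X hY hYX hlog j hj hjn c hc).trans ((hmono C₁ hC₁).trans ?_)
      rw [mul_div_assoc, mul_div_assoc]
      exact mul_le_mul_of_nonneg_right (by linarith) hunit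
    · -- `j + 1 > n`: the cell is empty
      have hempty : cellΩ ⌈Y⌉₊ ⌊X⌋₊ (j + 1) = ∅ := by
        refine roughIcc_filter_cardFactors_eq_empty ?_
        have h1 : X ≤ Y ^ n := le_pow_of_log_le hX0 hY0 hlog
        have h2 : Y ^ n < Y ^ (j + 1) := pow_lt_pow_right₀ (by linarith) hjn
        have h3 : (Y : ℝ) ^ (j + 1) ≤ ((⌈Y⌉₊ ^ (j + 1) : ℕ) : ℝ) := by
          push_cast; exact pow_le_pow_left₀ hY0.le (Nat.le_ceil Y) _
        have h4 : ((⌊X⌋₊ : ℕ) : ℝ) < ((⌈Y⌉₊ ^ (j + 1) : ℕ) : ℝ) := by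
          have := Nat.floor_le hX0.le; linarith
        exact_mod_cast h4
      rw [hempty]
      simp only [Finset.filter_empty, Finset.card_empty, Nat.cast_zero, zero_div, sub_zero, abs_zero,
        Finset.sum_const_zero]
      positivity
  · -- small `X`: the trivial bound
    push Not at hXlarge
    have hterm : ∀ q ∈ Finset.Icc 1 ⌊X ^ ((1 : ℝ) / 4)⌋₊,
        |(#((cellΩ ⌈Y⌉₊ ⌊X⌋₊ (j + 1)).filter (fun b : ℕ => b ≡ c q [MOD q])) : ℝ) -
          (#((cellΩ ⌈Y⌉₊ ⌊X⌋₊ (j + 1)).filter (fun b : ℕ => b.Coprime q)) : ℝ) / (Nat.totient q : ℝ)| ≤ X := by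
      intro q hq
      have hq0 : 0 < q := (Finset.mem_Icc.1 hq).1
      have hcard : ∀ (P : ℕ → Prop) [DecidablePred P],
          (#((cellΩ ⌈Y⌉₊ ⌊X⌋₊ (j + 1)).filter P) : ℝ) ≤ X := by
        intro P _
        calc (#((cellΩ ⌈Y⌉₊ ⌊X⌋₊ (j + 1)).filter P) : ℝ) ≤ #(Finset.Icc 1 ⌊X⌋₊) := by
              exact_mod_cast Finset.card_le_card ((Finset.filter_subset _ _).trans
                ((Finset.filter_subset _ _).trans (roughIcc_subset_Icc _ _)))
          _ = ⌊X⌋₊ := by simp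
          _ ≤ X := Nat.floor_le hX0.le
      exact abs_sub_div_le_of_le (Nat.cast_nonneg _) (hcard _) (Nat.cast_nonneg _) (hcard _)
        (by exact_mod_cast Nat.totient_pos.2 hq0)
    refine (Finset.sum_le_sum hterm).trans ?_
    rw [Finset.sum_const, nsmul_eq_mul, Nat.card_Icc, Nat.add_sub_cancel]
    -- `⌊X^{1/4}⌋ X ≤ Cs X / (log X)^A`
    have hQ : (⌊X ^ ((1 : ℝ) / 4)⌋₊ : ℝ) ≤ x₂ ^ (1 / 4 : ℝ) :=
      (Nat.floor_le (by positivity)).trans (Real.rpow_le_rpow hX0.le hXlarge.le (by norm_num))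
    have hLA : Real.log X ^ A ≤ Real.log x₂ ^ A + Real.log 2 ^ A := by
      have hlogle : Real.log X ≤ Real.log x₂ := Real.log_le_log hX0 hXlarge.le
      have hlog2le : Real.log 2 ≤ Real.log X := Real.log_le_log (by norm_num) (by linarith)
      rcases le_or_gt 0 A with hA | hA
      · have h1 : Real.log X ^ A ≤ Real.log x₂ ^ A := Real.rpow_le_rpow hlogX.le hlogle hA
        have h2 : 0 ≤ Real.log 2 ^ A := Real.rpow_nonneg hlog2.le A
        linarith
      · have h1 : Real.log X ^ A ≤ Real.log 2 ^ A := Real.rpow_le_rpow_of_nonpos hlog2 hlog2le hA.le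
        have h2 : 0 ≤ Real.log x₂ ^ A := Real.rpow_nonneg hlogx₂.le A
        linarith
    have hkey : (⌊X ^ ((1 : ℝ) / 4)⌋₊ : ℝ) * X ≤ Cs * X / Real.log X ^ A := by
      rw [le_div_iff₀ hpow, hCs]
      have h1 : (⌊X ^ ((1 : ℝ) / 4)⌋₊ : ℝ) * Real.log X ^ A ≤ x₂ ^ (1 / 4 : ℝ) * (Real.log x₂ ^ A + Real.log 2 ^ A) :=
        mul_le_mul hQ hLA hpow.le (by positivity)
      nlinarith
    refine hkey.trans ?_
    rw [mul_div_assoc, mul_div_assoc]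
    exact mul_le_mul_of_nonneg_right (by linarith) hunit

end RoughCellsAP

end Literature.NumberTheory.Sieve
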